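import Summits.AtomisticToContinuum.Crystallization.Theorems.OverbindingBudgetAffineRunCutLeg
import Summits.AtomisticToContinuum.Crystallization.Theorems.OverbindingBudgetAffineRunCutLegCover

/-!
# `OverbindingBudget` / crux `RobustDefectLimitWindows` (stmt-AtomisticToContinuum-31280) — «RunCut» part 23C-α «WALK»:
# THE GREEDY WALK EXISTS, ARRIVES EXACTLY, AND STAYS IN THE ENGINE'S WINDOWS

Support file (lens-4 g90; order of record (2c), `ρ₁ = 30`; memo `g90/memo/LEG-g90.md` §2/§4; architecture `g89/memo/ATLAS-STAR-g89.md` §1 (L), §2 (P), (S)).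
Part 23B-β `…RunCutLeg.leg_carry` carries a star line along a GIVEN chain of first-shell registrations; this file SUPPLIES the chains.
* §1 arithmetic of the endgame of a walk and of the windows: below the envelope's stop threshold the normalised law
  `R′² ≤ 1.0067 (R² − 1.412 R + 1.0023)` (tree `…RunCutLegCover.leg_law_normalise`) gives `R′ ≤ 1.07` from `1 ≤ R ≤ 3/2` (`law_below`) and then
  `R″ < 1` from `1 ≤ R′ ≤ 1.07` (`law_arrive`); and `R < 1` is ARRIVAL, because a site other than the target is at least its own nearest-neighbour
  distance away from it (`Literature…nearestDist_le_dist`).  So no `hex` / second-shell analysis is needed for the last bond.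
  Window algebra: `inv_window`, `window_compose`, `engine_window` (exponent `≤ 35` ⇒ `[0.888, 1.04]`, 23B-β `scale_budget`), `pow17_le`.
* §2 ★★ `greedy_walk` (section `Atlas`, the chart datum of parts 22A–23B verbatim): from ANY charted `p` toward ANY site `q` with
  `dist(y p, y q) ≤ 10.78 ν_p` and the metric ball `B(y q, dist(y p, y q))` inside the chart ball, the greedy chain of `…RunCutLegCover.space_step`
  registrations ARRIVES AT `q` within `17` bonds (15 envelope rungs of `leg_envelope` + the two endgame bonds), never leaving `B(y q, dist(y p, y q))`
  (the absolute law decreases the distance while `d ≥ ν`).  The chain is produced by `choose` + `Nat.rec` inside the proof (no definitions); the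
  arrival time is the LEAST one (`Nat.find`), so every earlier site differs from `q`.
* §3 ★★ `hub_leg` — THE CHAIN 23C-β «HUB» CONSUMES: for a mover `i` (`dist(y i, y j) ≤ 5/2 ν_j`, `ρ₁ ≥ 30`) and any site `m` with `dist(y m, y i) ≤ 10 ν_i`
  a chain `m = c 0 → … → c n = i`, `n ≤ 17`, of first-shell registrations, every site within `13 ν_j` of `y j` (the engine's `D = 13`), inside the
  chart ball, and with `0.888 ν_j ≤ ν_{c t} ≤ 1.04 ν_j` (the engine's `lo`, `hi`).  THREE walks: `j → i` (window of the mover, ≤ 17 bonds),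
  `i → m` (only for the scale of `m`: `ν_i ≤ 1.0011^17 ν_m`, so `R₀(m → i) ≤ 10.19 ≤ 10.78`), `m → i` (the leg proper; windows `(n − t) + 17 ≤ 34 ≤ 35`).
[this file: 0 definitions; imports tree `…RunCutLeg` (23B-β, p856275) + tree `…RunCutLegCover`; standard axioms]
-/

namespace Summit.AtomisticToContinuum.Crystallization.Theorems.OverbindingBudgetAffineRunCutWalk

open scoped InnerProductSpace
open Literature.Geometry.DiscreteGeometry
open Summit.AtomisticToContinuum.Crystallization.Theorems.OverbindingBudgetAffineCompressedCutEstablish (nearestDist_pos_of_frame)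
open Summit.AtomisticToContinuum.Crystallization.Theorems.OverbindingBudgetAffineRunCutLegCover (space_step leg_law_normalise leg_envelope)
open Summit.AtomisticToContinuum.Crystallization.Theorems.OverbindingBudgetAffineRunCutLeg
  (bond_windows leg_scale leg_scale_end scale_budget)

variable {N : ℕ}
local notation "E3" => EuclideanSpace ℝ (Fin 3)

/-! ## §1 Arithmetic: the endgame of a walk, window algebra -/

/-- Endgame, first bond: from `1 ≤ R ≤ 3/2` the normalised law gives `R′ ≤ 1.07` (`G(3/2) = 1.14190 ≤ 1.07²`). [this file] -/
theorem law_below {R R' : ℝ} (h1 : 1 ≤ R) (h2 : R ≤ 3 / 2) (hR' : 0 ≤ R')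
    (hlaw : R' ^ 2 ≤ 10067 / 10000 * (R ^ 2 - 1412 / 1000 * R + 10023 / 10000)) : R' ≤ 107 / 100 := by
  have hm : 0 ≤ (3 / 2 - R) * (R + 3 / 2 - 1412 / 1000) := mul_nonneg (by linarith) (by linarith)
  have hsq : R' ^ 2 ≤ (107 / 100) ^ 2 := by nlinarith
  exact (pow_le_pow_iff_left₀ hR' (by norm_num) two_ne_zero).1 hsq

/-- Endgame, second bond: from `1 ≤ R ≤ 1.07` the normalised law gives `R′ < 1` (`G(1.07) = 0.6407`) — i.e. ARRIVAL (§2). [this file] -/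
theorem law_arrive {R R' : ℝ} (h1 : 1 ≤ R) (h2 : R ≤ 107 / 100) (hR' : 0 ≤ R')
    (hlaw : R' ^ 2 ≤ 10067 / 10000 * (R ^ 2 - 1412 / 1000 * R + 10023 / 10000)) : R' < 1 := by
  have hm : 0 ≤ (107 / 100 - R) * (R + 107 / 100 - 1412 / 1000) := mul_nonneg (by linarith) (by linarith)
  nlinarith

/-- The lower window read backwards: `(10⁴/10011)^n x ≤ y ⇒ x ≤ (10011/10⁴)^n y`. [formal bookkeeping] -/
theorem inv_window {x y : ℝ} {n : ℕ} (h : (10000 / 10011 : ℝ) ^ n * x ≤ y) : x ≤ (10011 / 10000 : ℝ) ^ n * y := by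
  have e : (10011 / 10000 : ℝ) ^ n * ((10000 / 10011 : ℝ) ^ n * x) = x := by
    rw [← mul_assoc, ← mul_pow]; norm_num
  calc x = (10011 / 10000 : ℝ) ^ n * ((10000 / 10011 : ℝ) ^ n * x) := e.symm
    _ ≤ (10011 / 10000 : ℝ) ^ n * y := mul_le_mul_of_nonneg_left h (pow_nonneg (by norm_num) n)

/-- Two windows compose by adding exponents. [formal bookkeeping] -/
theorem window_compose {x y z : ℝ} {s t : ℕ} (h1 : (10000 / 10011 : ℝ) ^ s * x ≤ y) (h2 : y ≤ (10011 / 10000 : ℝ) ^ s * x)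
    (h3 : (10000 / 10011 : ℝ) ^ t * y ≤ z) (h4 : z ≤ (10011 / 10000 : ℝ) ^ t * y) :
    (10000 / 10011 : ℝ) ^ (s + t) * x ≤ z ∧ z ≤ (10011 / 10000 : ℝ) ^ (s + t) * x := by
  have ha : (0 : ℝ) ≤ (10000 / 10011 : ℝ) ^ t := pow_nonneg (by norm_num) t
  have hb : (0 : ℝ) ≤ (10011 / 10000 : ℝ) ^ t := pow_nonneg (by norm_num) t
  constructor
  · calc (10000 / 10011 : ℝ) ^ (s + t) * x = (10000 / 10011 : ℝ) ^ t * ((10000 / 10011 : ℝ) ^ s * x) := by rw [pow_add]; ring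
      _ ≤ (10000 / 10011 : ℝ) ^ t * y := mul_le_mul_of_nonneg_left h1 ha
      _ ≤ z := h3
  · calc z ≤ (10011 / 10000 : ℝ) ^ t * y := h4
      _ ≤ (10011 / 10000 : ℝ) ^ t * ((10011 / 10000 : ℝ) ^ s * x) := mul_le_mul_of_nonneg_left h2 hb
      _ = (10011 / 10000 : ℝ) ^ (s + t) * x := by rw [pow_add]; ring

/-- A window of exponent `≤ 35` about `ν_j ≥ 0` lies inside the engine's `[0.888 ν_j, 1.04 ν_j]` (23B-β `scale_budget`). [this file] -/
theorem engine_window {x z : ℝ} {s : ℕ} (hs : s ≤ 35) (hx : 0 ≤ x) (h1 : (10000 / 10011 : ℝ) ^ s * x ≤ z)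
    (h2 : z ≤ (10011 / 10000 : ℝ) ^ s * x) : 888 / 1000 * x ≤ z ∧ z ≤ 104 / 100 * x := by
  obtain ⟨hl, hr⟩ := scale_budget hs
  exact ⟨(mul_le_mul_of_nonneg_right hl hx).trans h1, h2.trans (mul_le_mul_of_nonneg_right hr hx)⟩

/-- `(10011/10⁴)^s ≤ 1.019` for `s ≤ 17` (`1.0011^17 = 1.01887`): the scale of the far end of one walk. [this file] -/
theorem pow17_le {s : ℕ} (hs : s ≤ 17) : (10011 / 10000 : ℝ) ^ s ≤ 1019 / 1000 :=
  (pow_le_pow_right₀ (by norm_num) hs).trans (by norm_num)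

section Atlas
/-! ONE chart datum on the ball `B(y j, ρ₁ ν_j)` (verbatim §2 of part 22A). -/
variable {y : Fin N → E3} (hy : Function.Injective y) {j : Fin N} {ρ₁ : ℝ}
  {Ac : Fin N → (E3 →ₗ[ℝ] E3)} {Qc : Fin N → (E3 →ₗᵢ[ℝ] E3)} {Pc : Fin N → Finset E3} {fc : Fin N → E3 → E3}
  (hP : ∀ i, dist (y i) (y j) ≤ ρ₁ * nearestDist y j → Pc i = fccTwoShellPattern ∨ Pc i = hcpTwoShellPattern)
  (hA : ∀ i, dist (y i) (y j) ≤ ρ₁ * nearestDist y j → ∀ v ∈ Pc i, ‖Ac i v - Qc i v‖ ≤ 1 / 1000)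
  (hf : ∀ i, dist (y i) (y j) ≤ ρ₁ * nearestDist y j → ∀ v ∈ Pc i,
    fc i v ∈ Set.range y ∧ dist (fc i v) (y i + nearestDist y i • Ac i v) ≤ 1 / 10 ^ 4 * nearestDist y i)
  (hinj : ∀ i, dist (y i) (y j) ≤ ρ₁ * nearestDist y j → Set.InjOn (fc i) ↑(Pc i))
  (hex : ∀ i, dist (y i) (y j) ≤ ρ₁ * nearestDist y j → ∀ k : Fin N, k ≠ i →
    dist (y k) (y i) ≤ (3 / 2 + 1 / 450) * nearestDist y i → ∃ v ∈ Pc i, fc i v = y k)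

include hy hP hA hf hinj hex

/-! ## §2 The greedy walk exists and arrives -/

/-- ★★ **THE GREEDY WALK ARRIVES.**  From a charted site `p` toward a site `q` with `dist(y p, y q) ≤ 10.78·ν_p`, the closed ball
`B(y q, dist(y p, y q))` lying inside the chart ball: a chain `p = c 0 → c 1 → … → c n = q` of FIRST-SHELL registrations (`u t ∈ P_{c t}`, `‖u t‖ = 1`,
`f_{c t}(u t) = y_{c (t+1)}`), `n ≤ 17`, all of whose sites stay in `B(y q, dist(y p, y q))`.  Construction: at each site the greedy label of
`…RunCutLegCover.space_step` toward `y q`; while not arrived the distance to `q` is `≥ ν` (`nearestDist_le_dist`), so the absolute law makes it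
non-increasing (sites stay charted) and the normalised law holds (`leg_law_normalise`, scale ratio from 23B-β `bond_windows`); `leg_envelope`: `R ≤ 3/2`
within `15` bonds, then `law_below`, `law_arrive`: `R < 1`, contradiction with `R ≥ 1` — so the walk has arrived by bond `17`; `n` := the first arrival.
[this file] -/
theorem greedy_walk {p q : Fin N} (hcont : ∀ z : Fin N, dist (y z) (y q) ≤ dist (y p) (y q) → dist (y z) (y j) ≤ ρ₁ * nearestDist y j)
    (hR0 : dist (y p) (y q) ≤ 539 / 50 * nearestDist y p) :
    ∃ n, n ≤ 17 ∧ ∃ c : ℕ → Fin N, ∃ u : ℕ → E3, c 0 = p ∧ c n = q ∧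
      (∀ t < n, u t ∈ Pc (c t) ∧ ‖u t‖ = 1 ∧ fc (c t) (u t) = y (c (t + 1))) ∧
      (∀ t ≤ n, dist (y (c t)) (y q) ≤ dist (y p) (y q)) := by
  -- one greedy step from every charted site other than the target
  have key : ∀ z : Fin N, ∃ z' : Fin N, ∃ u : E3, dist (y z) (y j) ≤ ρ₁ * nearestDist y j → z ≠ q →
      u ∈ Pc z ∧ ‖u‖ = 1 ∧ fc z u = y z' ∧
        dist (y z') (y q) ^ 2 ≤ dist (y z) (y q) ^ 2 - 1412 / 1000 * nearestDist y z * dist (y z) (y q) + 10023 / 10000 * nearestDist y z ^ 2 := by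
    intro z
    by_cases hz : dist (y z) (y j) ≤ ρ₁ * nearestDist y j
    · obtain ⟨u, hu, hu1, H⟩ := space_step hy (hP z hz) (hA z hz) (hf z hz) (hinj z hz) (y q - y z)
      obtain ⟨z', hz'⟩ := (hf z hz u hu).1
      obtain ⟨-, -, hlaw⟩ := H z' hz'.symm
      refine ⟨z', u, fun _ _ => ⟨hu, hu1, hz'.symm, ?_⟩⟩
      have e1 : y q - y z - (y z' - y z) = y q - y z' := by abel
      rw [e1, ← dist_eq_norm, ← dist_eq_norm, dist_comm (y q) (y z'), dist_comm (y q) (y z)] at hlaw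
      exact hlaw
    · exact ⟨z, 0, fun h _ => absurd h hz⟩
  choose F U hFU using key
  obtain ⟨c, hc0, hcS⟩ : ∃ c : ℕ → Fin N, c 0 = p ∧ ∀ t, c (t + 1) = F (c t) :=
    ⟨fun t => Nat.rec (motive := fun _ => Fin N) p (fun _ z => F z) t, rfl, fun _ => rfl⟩
  -- the invariant while the walk has not arrived
  have inv : ∀ t : ℕ, (∀ s < t, c s ≠ q) →
      (∀ s ≤ t, dist (y (c s)) (y q) ≤ dist (y p) (y q)) ∧
      (∀ s < t, U (c s) ∈ Pc (c s) ∧ ‖U (c s)‖ = 1 ∧ fc (c s) (U (c s)) = y (c (s + 1))) ∧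
      (∀ s < t, (dist (y (c (s + 1))) (y q) / nearestDist y (c (s + 1))) ^ 2 ≤
        10067 / 10000 * ((dist (y (c s)) (y q) / nearestDist y (c s)) ^ 2
          - 1412 / 1000 * (dist (y (c s)) (y q) / nearestDist y (c s)) + 10023 / 10000)) := by
    intro t
    induction t with
    | zero =>
      intro _
      refine ⟨fun s hs => ?_, fun s hs => absurd hs (Nat.not_lt_zero _), fun s hs => absurd hs (Nat.not_lt_zero _)⟩
      obtain rfl : s = 0 := Nat.le_zero.1 hs
      rw [hc0]
    | succ t ih =>
      intro hne
      obtain ⟨hd, hch, hlw⟩ := ih (fun s hs => hne s (Nat.lt_succ_of_lt hs))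
      have hzq : c t ≠ q := hne t (Nat.lt_succ_self t)
      have hbt : dist (y (c t)) (y j) ≤ ρ₁ * nearestDist y j := hcont _ (hd t le_rfl)
      obtain ⟨hu, hu1, hfu, hl⟩ := hFU (c t) hbt hzq
      rw [← hcS] at hfu hl
      have hνpos : 0 < nearestDist y (c t) := nearestDist_pos_of_frame hy (hP _ hbt) (fun v hv => (hf _ hbt v hv).1) (hinj _ hbt)
      have hνd : nearestDist y (c t) ≤ dist (y (c t)) (y q) := nearestDist_le_dist y hzq.symm
      have hdec : dist (y (c (t + 1))) (y q) ≤ dist (y (c t)) (y q) := by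
        have h2 : dist (y (c (t + 1))) (y q) ^ 2 ≤ dist (y (c t)) (y q) ^ 2 := by
          nlinarith [hl, mul_nonneg hνpos.le (sub_nonneg.2 hνd), hνpos.le]
        exact (pow_le_pow_iff_left₀ dist_nonneg dist_nonneg two_ne_zero).1 h2
      have hd1 : dist (y (c (t + 1))) (y q) ≤ dist (y p) (y q) := hdec.trans (hd t le_rfl)
      have hbt1 : dist (y (c (t + 1))) (y j) ≤ ρ₁ * nearestDist y j := hcont _ hd1
      obtain ⟨-, ⟨hlo, -⟩, -⟩ := bond_windows hy hP hA hf hinj hex hbt hbt1 hu hu1 hfu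
      have hlawn := leg_law_normalise hνpos hlo hl
      refine ⟨fun s hs => ?_, fun s hs => ?_, fun s hs => ?_⟩
      · rcases Nat.lt_or_eq_of_le hs with hs' | rfl
        · exact hd s (Nat.lt_succ_iff.1 hs')
        · exact hd1
      · rcases Nat.lt_or_eq_of_le (Nat.lt_succ_iff.1 hs) with hs' | rfl
        · exact hch s hs'
        · exact ⟨hu, hu1, hfu⟩
      · rcases Nat.lt_or_eq_of_le (Nat.lt_succ_iff.1 hs) with hs' | rfl
        · exact hlw s hs'
        · exact hlawn
  -- arrival by bond 17
  have harr : ∃ n, n ≤ 17 ∧ c n = q := by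
    by_contra hno'
    have hno : ∀ s ≤ 17, c s ≠ q := fun s hs h => hno' ⟨s, hs, h⟩
    obtain ⟨hd, -, hlw⟩ := inv 17 (fun s hs => hno s hs.le)
    have hR1 : ∀ s ≤ 17, 1 ≤ dist (y (c s)) (y q) / nearestDist y (c s) := by
      intro s hs
      have hbs : dist (y (c s)) (y j) ≤ ρ₁ * nearestDist y j := hcont _ (hd s hs)
      have hνpos : 0 < nearestDist y (c s) := nearestDist_pos_of_frame hy (hP _ hbs) (fun v hv => (hf _ hbs v hv).1) (hinj _ hbs)
      exact (one_le_div hνpos).2 (nearestDist_le_dist y (hno s hs).symm)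
    have hR0' : ∀ s, 0 ≤ dist (y (c s)) (y q) / nearestDist y (c s) := fun s => div_nonneg dist_nonneg (nearestDist_nonneg _ _)
    have hp0 : dist (y p) (y j) ≤ ρ₁ * nearestDist y j := hcont p le_rfl
    have hνp : 0 < nearestDist y p := nearestDist_pos_of_frame hy (hP _ hp0) (fun v hv => (hf _ hp0 v hv).1) (hinj _ hp0)
    have hstart : dist (y (c 0)) (y q) / nearestDist y (c 0) ≤ 539 / 50 := by rw [hc0, div_le_iff₀ hνp]; exact hR0
    obtain ⟨s, hs15, hs32⟩ := (leg_envelope (fun s => dist (y (c s)) (y q) / nearestDist y (c s)) 0 15 hR0'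
      (fun s hs _ => by rw [zero_add]; exact hlw s (by omega))).1 le_rfl hstart
    rw [zero_add] at hs32
    have h1 := law_below (hR1 s (by omega)) hs32 (hR0' (s + 1)) (hlw s (by omega))
    have h2 := law_arrive (hR1 (s + 1) (by omega)) h1 (hR0' (s + 1 + 1)) (hlw (s + 1) (by omega))
    exact absurd (hR1 (s + 1 + 1) (by omega)) (not_le.2 h2)
  obtain ⟨n, hn17, hcn⟩ := harr
  have hexq : ∃ n, c n = q := ⟨n, hcn⟩
  obtain ⟨hd, hch, -⟩ := inv (Nat.find hexq) (fun s hs => Nat.find_min hexq hs)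
  exact ⟨Nat.find hexq, (Nat.find_min' hexq hcn).trans hn17, c, fun t => U (c t), hc0, Nat.find_spec hexq, hch, hd⟩

/-! ## §3 The legs of the hub -/

/-- ★★ **THE LEG TO THE HUB, WINDOWED.**  `ρ₁ ≥ 30`; a mover `i` (`dist(y i, y j) ≤ 5/2 ν_j`) and any site `m` with `dist(y m, y i) ≤ 10 ν_i`: a chain
of first-shell registrations `m = c 0 → … → c n = i`, `n ≤ 17`, every site within `13 ν_j` of `y j` and inside the chart ball, with the engine's scale
window `0.888 ν_j ≤ ν_{c t} ≤ 1.04 ν_j`.  Three `greedy_walk`s: `j → i` (window of `i`, exponent `≤ 17`), `i → m` (scale of `m` only: `ν_i ≤ 1.019 ν_m`, so the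
third walk starts with `R₀ ≤ 10.19 ≤ 10.78`), `m → i` (the leg; its sites lie in `B(y i, 10 ν_i) ⊂ B(y j, 12.69 ν_j)`; windows by 23B-β `leg_scale_end`
composed with the mover's, exponent `≤ 34 ≤ 35`). [this file] -/
theorem hub_leg (hρ : 30 ≤ ρ₁) {i : Fin N} (hi : dist (y i) (y j) ≤ 5 / 2 * nearestDist y j) {m : Fin N}
    (hm : dist (y m) (y i) ≤ 10 * nearestDist y i) :
    ∃ n, n ≤ 17 ∧ ∃ c : ℕ → Fin N, ∃ u : ℕ → E3, c 0 = m ∧ c n = i ∧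
      (∀ t < n, u t ∈ Pc (c t) ∧ ‖u t‖ = 1 ∧ fc (c t) (u t) = y (c (t + 1))) ∧
      (∀ t ≤ n, dist (y (c t)) (y j) ≤ 13 * nearestDist y j ∧ dist (y (c t)) (y j) ≤ ρ₁ * nearestDist y j ∧
        888 / 1000 * nearestDist y j ≤ nearestDist y (c t) ∧ nearestDist y (c t) ≤ 104 / 100 * nearestDist y j) := by
  have hν0 : 0 ≤ nearestDist y j := nearestDist_nonneg _ _
  -- walk 1: `j → i`, the mover's window
  have hcont₀ : ∀ z : Fin N, dist (y z) (y i) ≤ dist (y j) (y i) → dist (y z) (y j) ≤ ρ₁ * nearestDist y j := by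
    intro z hz
    rw [dist_comm (y j) (y i)] at hz
    have := dist_triangle (y z) (y i) (y j)
    nlinarith
  have hj0 : dist (y j) (y j) ≤ ρ₁ * nearestDist y j := by rw [dist_self]; nlinarith
  have hνj : 0 < nearestDist y j := nearestDist_pos_of_frame hy (hP _ hj0) (fun v hv => (hf _ hj0 v hv).1) (hinj _ hj0)
  have hR₀ : dist (y j) (y i) ≤ 539 / 50 * nearestDist y j := by rw [dist_comm]; linarith
  obtain ⟨n₀, hn₀, c₀, u₀, hc₀0, hc₀n, hch₀, hd₀⟩ := greedy_walk hy hP hA hf hinj hex hcont₀ hR₀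
  obtain ⟨hwi1, hwi2, -⟩ := leg_scale hy hP hA hf hinj hex c₀ u₀ n₀ (fun t ht => hcont₀ _ (hd₀ t ht)) hch₀ n₀ le_rfl
  rw [hc₀0, hc₀n] at hwi1 hwi2
  have hνi := hwi2.trans (mul_le_mul_of_nonneg_right (pow17_le hn₀) hν0)
  have hi_ball : dist (y i) (y j) ≤ ρ₁ * nearestDist y j := hcont₀ i (by rw [dist_self]; exact dist_nonneg)
  have hνi0 : 0 < nearestDist y i := nearestDist_pos_of_frame hy (hP _ hi_ball) (fun v hv => (hf _ hi_ball v hv).1) (hinj _ hi_ball)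
  -- walk 2: `i → m`, only for the scale of `m`
  have hcont₁ : ∀ z : Fin N, dist (y z) (y m) ≤ dist (y i) (y m) → dist (y z) (y j) ≤ ρ₁ * nearestDist y j := by
    intro z hz
    rw [dist_comm (y i) (y m)] at hz
    have h1 := dist_triangle (y z) (y m) (y j)
    have h2 := dist_triangle (y m) (y i) (y j)
    nlinarith
  have hR₁ : dist (y i) (y m) ≤ 539 / 50 * nearestDist y i := by rw [dist_comm]; linarith
  obtain ⟨n₁, hn₁, c₁, u₁, hc₁0, hc₁n, hch₁, hd₁⟩ := greedy_walk hy hP hA hf hinj hex hcont₁ hR₁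
  obtain ⟨hwm1, -, -⟩ := leg_scale hy hP hA hf hinj hex c₁ u₁ n₁ (fun t ht => hcont₁ _ (hd₁ t ht)) hch₁ n₁ le_rfl
  rw [hc₁0, hc₁n] at hwm1
  have hνim := (inv_window hwm1).trans (mul_le_mul_of_nonneg_right (pow17_le hn₁) (nearestDist_nonneg _ _))
  -- walk 3: `m → i`, the leg
  have hcont : ∀ z : Fin N, dist (y z) (y i) ≤ dist (y m) (y i) → dist (y z) (y j) ≤ ρ₁ * nearestDist y j := by
    intro z hz
    have h1 := dist_triangle (y z) (y i) (y j)
    nlinarith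
  have hR : dist (y m) (y i) ≤ 539 / 50 * nearestDist y m := by nlinarith
  obtain ⟨n, hn, c, u, hcm, hcn, hch, hd⟩ := greedy_walk hy hP hA hf hinj hex hcont hR
  refine ⟨n, hn, c, u, hcm, hcn, hch, fun t ht => ?_⟩
  have hball : ∀ t ≤ n, dist (y (c t)) (y j) ≤ ρ₁ * nearestDist y j := fun t ht => hcont _ (hd t ht)
  obtain ⟨hw1, hw2⟩ := leg_scale_end hy hP hA hf hinj hex c u n hball hch t ht
  rw [hcn] at hw1 hw2
  obtain ⟨hl, hr⟩ := window_compose hwi1 hwi2 hw1 hw2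
  obtain ⟨hlo, hhi⟩ := engine_window (by omega) hν0 hl hr
  refine ⟨?_, hball t ht, hlo, hhi⟩
  have h1 := dist_triangle (y (c t)) (y i) (y j)
  nlinarith [hd t ht]

end Atlas

end Summit.AtomisticToContinuum.Crystallization.Theorems.OverbindingBudgetAffineRunCutWalk
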